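import Summits.BirchSwinnertonDyer.Rank1Residual.X11b.BDPRouteOpenInputDescent
import Summits.BirchSwinnertonDyer.Rank1Residual.X11b.BDPRouteHsiehFrame
import Summits.BirchSwinnertonDyer.Rank1Residual.X11b.LambdaSupplyPrime
import Literature.NumberTheory.EllipticCurves.Hsieh2014.AnticyclotomicMuInvariantAnyLevel
import Literature.NumberTheory.EllipticCurves.Hida2010MuInvariant.AnticyclotomicKatzBranchMuInvariant
import HarnessLib

set_option linter.dupNamespace false -- `Summit.BirchSwinnertonDyer.BirchSwinnertonDyer.Theorems.…` (summit = sub)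
set_option autoImplicit false

/-!
# Crux (E♭°) `EisensteinDivisibilityCMInertBadFlatAtOne` (stmt-BirchSwinnertonDyer-20452), line `birth`:
# stub `stub_E2` (`μ = 0`: `p ∤ L` for EVERY `R₀`-frame `L`) REDUCED to Hsieh's Theorem B at any level —
# CONDITIONAL helper (named fact `Hsieh2014.thmB_exists_isHsiehLFunction_coeff_norm_eq_one_unrPeriod_anyLevel`)

Route `BiquadraticEisensteinDescent` (cell `pub/bsd-wall`, lead-prover seat `bsd-wall-bed-p1`, g2). Skeleton of
record v2 (sha16 `c35ce51d8c75e0b4`): stubs `stub_E0`, `stub_E1B`, `stub_E2` (+ landed `stub_E3`, proved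
`stub_Ea`). `stub_E2` says: every `L ∈ R₀⟦T⟧` with Castella's interpolation property
`IsBDPLFunction ι′ 𝔭 κ γ f Ω_K′ Ω_p L` at the datum is NOT divisible by `p`. This file proves it from TWO inputs
that are not binders of the crux, and from nothing else:

* (B) the NAMED FACT `Hsieh2014.thmB_exists_isHsiehLFunction_coeff_norm_eq_one_unrPeriod_anyLevel` (Hsieh,
  Doc. Math. 19 (2014) Thm. B at any level, typed by bed-p1 g0, p512129): a Hsieh frame `Q` with a
  coefficient of norm one;
* (Irr) hypothesis (2) of that theorem for the pair: every framed mod-`p` representation of `E/K′` is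
  absolutely irreducible (for a CM curve at an inert `p ≥ 5` and `K′ ≠ K_CM` this is the statement
  "`ψ̄_E(G_{K_CM K′}) ⊄ 𝔽_p^×`"; no tree theorem supplies it, so it stays a hypothesis here).

Chain (all other steps are tree theorems): the λ-supply at `(ι′, K′, κ)` (`X11b.lambdaSupplyAt`, odd `p`) feeds
(B); Hsieh's frame becomes a Castella ♭-frame `C(c)·Q`, `‖c‖ = 1` (`X11b.exists_isBDPLFunctionInt_of_isHsiehLFunction`,
`p ∣ N`), which still has UNIT CONTENT (`GreenbergVatsal2000.HasUnitContent`, invariant under units); ANY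
`R₀`-frame `L` read in `𝓞_{ℂ_p}⟦T⟧` is a unit multiple of it (ideal rigidity across periods
`X11b.R1.exists_unit_mul_eq_of_isBDPLFunctionInt`), hence has unit content, i.e. a coefficient of norm one, which
forbids `p ∣ L` in `R₀⟦T⟧`.

* §1 `not_C_dvd_of_norm_coeff_eq_one`, `exists_norm_coeff_eq_one_of_hasUnitContent_map`,
  `hasUnitContent_map_of_isBDPLFunction_of_hasUnitContent` (generic, every odd `p`).
* §2 `exists_flatFrame_hasUnitContent_of_thmB_anyLevel` — (B) + (Irr) ⟹ a ♭-frame with unit content at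
  `(ι′, 𝔭, κ, γ, f)`, `p ∣ N`, `K′` Heegner for `N`.
* §3 `not_C_dvd_of_isBDPLFunction_of_thmB_anyLevel` — (B) + (Irr) ⟹ `p ∤ L` for every `R₀`-frame `L`;
  `stub_E2_of_thmB_anyLevel_of_absIrr` — the registered `stub_E2` signature with the two inputs added as
  hypotheses (so it is a HELPER, not the stub: CONDITIONAL on (B), and (Irr) undischarged).

THEOREMS ONLY (no definition, no named fact, no `sorry`); imports no `Theses` module; nothing about the crux,
(Irr) for any curve, or any case of BSD is asserted. Supports, does not close, stmt-BirchSwinnertonDyer-20452.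

References: [Hsieh2014] M.-L. Hsieh, Doc. Math. 19 (2014) 709–767, Thm. A, Thm. B (p. 712);
[Castella2018] Thm. 3.1 (arXiv:1704.06608 p. 9); [GreenbergVatsal2000] p. 2 (1)–(2) (the `μ = 0` token).
-/

noncomputable section

open scoped Classical

open PowerSeries NumberField IsDedekindDomain Field WeierstrassCurve
  Literature.NumberTheory.EllipticCurves Literature.NumberTheory.EllipticCurves.ModularForms
  Literature.NumberTheory.EllipticCurves.Rank1Residual
  Literature.NumberTheory.GaloisRepresentations Literature.NumberTheory.Automorphic
  Literature.NumberTheory.EllipticCurves.GreenbergVatsal2000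
  Literature.NumberTheory.EllipticCurves.Hida2010MuInvariant
  Literature.NumberTheory.EllipticCurves.Hsieh2014
  Summit.BirchSwinnertonDyer.Rank1Residual.X11b

namespace Summit.BirchSwinnertonDyer.BirchSwinnertonDyer.Theorems.BiquadraticEisensteinDescentEisensteinDivisibilityCMInertBadFlatAtOneStubE2

variable {p : ℕ} [Fact p.Prime]

/-! ### §1 Unit content in `R₀⟦T⟧` and its transport through frames -/

/-- **A coefficient of norm one forbids divisibility by `p` in `R₀⟦T⟧`**: if `‖[Tⁿ]L‖ = 1` for some `n`
then `p ∤ L` (every coefficient of `p·M` has norm `≤ ‖p‖ < 1`). [folklore] -/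
theorem not_C_dvd_of_norm_coeff_eq_one {L : UnrSeries p} {n : ℕ}
    (h : ‖((PowerSeries.coeff n L : unrIntegers p) : ℂ_[p])‖ = 1) :
    ¬ ((PowerSeries.C ((p : ℕ) : unrIntegers p) : UnrSeries p) ∣ L) := by
  rintro ⟨M, rfl⟩
  have hp : p.Prime := Fact.out
  rw [PowerSeries.coeff_C_mul, Subring.coe_mul, norm_mul] at h
  have h1 : ‖(((p : ℕ) : unrIntegers p) : ℂ_[p])‖ < 1 := by
    rw [show (((p : ℕ) : unrIntegers p) : ℂ_[p]) = ((p : ℚ_[p]) : ℂ_[p]) by simp,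
      PadicComplex.norm_extends', Padic.norm_p]
    exact inv_lt_one_of_one_lt₀ (by exact_mod_cast hp.one_lt)
  have h2 : ‖((PowerSeries.coeff n M : unrIntegers p) : ℂ_[p])‖ ≤ 1 :=
    Halves.norm_coe_unrIntegers_le_one p _
  have : ‖(((p : ℕ) : unrIntegers p) : ℂ_[p])‖ * ‖((PowerSeries.coeff n M : unrIntegers p) : ℂ_[p])‖ < 1 := by
    calc _ ≤ ‖(((p : ℕ) : unrIntegers p) : ℂ_[p])‖ * 1 :=
          mul_le_mul_of_nonneg_left h2 (norm_nonneg _)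
      _ < 1 := by rw [mul_one]; exact h1
  exact absurd h this.ne

/-- **Unit content of `L` read in `𝓞_{ℂ_p}⟦T⟧` is a coefficient of `L` of norm one** (same coefficients in
`ℂ_p`). [cite: GreenbergVatsal2000, p. 2 (1)–(2)] -/
theorem exists_norm_coeff_eq_one_of_hasUnitContent_map {L : UnrSeries p}
    (h : HasUnitContent (PowerSeries.map (R1.unrToCpInt p) L)) :
    ∃ n : ℕ, ‖((PowerSeries.coeff n L : unrIntegers p) : ℂ_[p])‖ = 1 := by
  obtain ⟨n, hn⟩ := (hasUnitContent_iff_exists_norm_coeff_eq_one _).mp h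
  refine ⟨n, ?_⟩
  rwa [PowerSeries.coeff_map, R1.coe_unrToCpInt] at hn

variable {K : Type} [Field K] [NumberField K] {N : ℕ} {ι : PadicAlgCl p ≃+* ℂ}
  {𝔭 : HeightOneSpectrum (𝓞 K)} {κ : ZpExtension K p} {γ : Field.absoluteGaloisGroup K}
  {f : CuspForm (CongruenceSubgroup.Gamma0 N) 2}

/-- **Unit content passes from ONE ♭-frame to EVERY `R₀`-frame of the same datum.** For `p` odd, `K`
imaginary quadratic, `κ` anticyclotomic with topological generator `γ`: if some ♭-frame `Q`
(`X11b.R1.IsBDPLFunctionInt p ι 𝔭 κ γ f Ω_K Ω_p Q`, `Ω_K, Ω_p ≠ 0`) has unit content, then every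
`R₀`-frame `L` (`IsBDPLFunction ι 𝔭 κ γ f Ω_K₁ Ω_p₁ L`, `Ω_K₁, Ω_p₁ ≠ 0`), read in `𝓞_{ℂ_p}⟦T⟧`, has unit
content: `map L = U·Q` with `U` a unit (`X11b.R1.exists_unit_mul_eq_of_isBDPLFunctionInt`) and unit content is
invariant under units over the local ring `𝓞_{ℂ_p}` (`hasUnitContent_congr_of_associated`).
[cite: Castella2018, Thm. 3.1 (arXiv:1704.06608 p. 9)] [cite: GreenbergVatsal2000, p. 2 (2)] -/
theorem hasUnitContent_map_of_isBDPLFunction_of_hasUnitContent (hp2 : p ≠ 2) (hK : IsImaginaryQuadratic K)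
    (hκ : κ.IsAnticyclotomic) (hγ : κ.IsTopGenerator γ)
    {ΩK ΩK₁ : ℂ} {Ωp Ωp₁ : ℂ_[p]} {Q : PowerSeries 𝓞_ℂ_[p]} {L : UnrSeries p}
    (hΩK : ΩK ≠ 0) (hΩK₁ : ΩK₁ ≠ 0) (hΩp : Ωp ≠ 0) (hΩp₁ : Ωp₁ ≠ 0)
    (hQ : R1.IsBDPLFunctionInt p ι 𝔭 κ γ f ΩK Ωp Q) (hQc : HasUnitContent Q)
    (hL : IsBDPLFunction ι 𝔭 κ γ f ΩK₁ Ωp₁ L) :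
    HasUnitContent (PowerSeries.map (R1.unrToCpInt p) L) := by
  obtain ⟨U, hU, hUQ⟩ := R1.exists_unit_mul_eq_of_isBDPLFunctionInt hp2 hK hκ hγ hΩK hΩK₁ hΩp hΩp₁ hQ
    (R1.isBDPLFunctionInt_map hL)
  have hass : Associated Q (PowerSeries.map (R1.unrToCpInt p) L) := by
    obtain ⟨u, rfl⟩ := hU
    exact ⟨u, by rw [hUQ, mul_comm]⟩
  exact (hasUnitContent_congr_of_associated hass).mp hQc

/-! ### §2 A ♭-frame with unit content from Hsieh's Theorem B at any level -/

/-- **(B) + (Irr) ⟹ a Castella ♭-frame WITH UNIT CONTENT** at `(ι, 𝔭, κ, γ, f)`: for `p` odd with `p ∣ N`,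
`f` a newform of `W` of level `N`, `K` imaginary quadratic satisfying the Heegner hypothesis for `N` (so `p`
splits), `𝔭 ∋ p` the prime induced by `ι`, `κ` anticyclotomic with topological generator `γ`, and every framed
mod-`p` representation of `W/K` absolutely irreducible: Hsieh's Thm. B frame `Q` (fed by the λ-supply
`X11b.lambdaSupplyAt`) has a coefficient of norm one, and its Castella renormalisation `C(c)·Q` with `‖c‖ = 1`
(`X11b.exists_isBDPLFunctionInt_of_isHsiehLFunction`) keeps unit content. CONDITIONAL on the named fact (B).
[cite: Hsieh2014, Thm. B p. 712 (Doc. Math. 19)] [cite: Castella2018, Thm. 3.1 (arXiv:1704.06608 p. 9)] -/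
theorem exists_flatFrame_hasUnitContent_of_thmB_anyLevel
    (hB : thmB_exists_isHsiehLFunction_coeff_norm_eq_one_unrPeriod_anyLevel)
    (W : WeierstrassCurve ℚ) [W.IsElliptic] [NeZero N] (hp2 : p ≠ 2) (hpN : p ∣ N) (hf : IsNewformOf W f)
    (hK : IsImaginaryQuadratic K) (hHN : SatisfiesHeegnerHypothesis N K)
    (h𝔭 : ((p : ℕ) : 𝓞 K) ∈ 𝔭.asIdeal)
    (hι : ∀ (w : InfinitePlace K) (k : 𝓞 K), k ∈ 𝔭.asIdeal ↔ ‖ι.symm (w.embedding (k : K))‖ < 1)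
    (hIrr : ∀ ρ : ModPGaloisRep K (ZMod p) 2, (W.baseChange K).IsTorsionGaloisRep p ρ →
      FramedRep.IsAbsolutelyIrreducible ρ)
    (hκ : κ.IsAnticyclotomic) (hγ : κ.IsTopGenerator γ) :
    ∃ (ΩK : ℂ) (Ωp : (unrIntegers p)ˣ) (Q : PowerSeries 𝓞_ℂ_[p]), ΩK ≠ 0 ∧
      R1.IsBDPLFunctionInt p ι 𝔭 κ γ f ΩK ((Ωp : unrIntegers p) : ℂ_[p]) Q ∧ HasUnitContent Q := by
  have hp : p.Prime := Fact.out
  have hsplit : ((Ideal.span {(p : ℤ)}).primesOver (𝓞 K)).ncard = 2 := hHN p hp hpN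
  obtain ⟨lam, rlam, hunit, hinfl, hAQ, hunrl, havl, hfacl⟩ := lambdaSupplyAt hp2 ι K κ hK hκ
  obtain ⟨A, ΩK, C, Ωp, Q, hA0, hΩK, hC, hQ, n, hn⟩ :=
    hB ι K 𝔭 κ γ W f lam rlam hp2 hf hK hsplit h𝔭 hι hHN hIrr hunit hinfl hAQ hunrl havl hfacl hκ hγ
  obtain ⟨ΩK₁, c, hΩK₁, hc1, hBDP⟩ :=
    exists_isBDPLFunctionInt_of_isHsiehLFunction ι 𝔭 κ γ f hpN hA0 hΩK hC
      ((Ωp : unrIntegers p) : ℂ_[p]) hQ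
  refine ⟨ΩK₁, Ωp, PowerSeries.C c * Q, hΩK₁, hBDP, ?_⟩
  -- unit content of `Q` survives the unit `c`
  have hQc : HasUnitContent Q :=
    (hasUnitContent_iff_exists_norm_coeff_eq_one Q).mpr ⟨n, hn⟩
  have hcU : IsUnit (PowerSeries.C c : PowerSeries 𝓞_ℂ_[p]) :=
    (isUnit_padicComplexInt_of_norm_eq_one hc1).map (PowerSeries.C : 𝓞_ℂ_[p] →+* PowerSeries 𝓞_ℂ_[p])
  have hass : Associated Q (PowerSeries.C c * Q) := by
    obtain ⟨u, hu⟩ := hcU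
    exact ⟨u, by rw [hu, mul_comm]⟩
  exact (hasUnitContent_congr_of_associated hass).mp hQc

/-! ### §3 `stub_E2` from (B) and (Irr) -/

/-- **(B) + (Irr) ⟹ `p ∤ L` for EVERY `R₀`-frame `L` of the datum** (`Ω_K₁ ≠ 0`, `Ω_p₁ ∈ R₀ˣ`): the
♭-frame with unit content of §2, ideal rigidity across periods, unit content of `map L`, a coefficient of `L`
of norm one, `not_C_dvd_of_norm_coeff_eq_one`. CONDITIONAL on the named fact (B); (Irr) a hypothesis.
[cite: Hsieh2014, Thm. B p. 712 (Doc. Math. 19)] [cite: Castella2018, Thm. 3.1 (arXiv:1704.06608 p. 9)] -/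
theorem not_C_dvd_of_isBDPLFunction_of_thmB_anyLevel
    (hB : thmB_exists_isHsiehLFunction_coeff_norm_eq_one_unrPeriod_anyLevel)
    (W : WeierstrassCurve ℚ) [W.IsElliptic] [NeZero N] (hp2 : p ≠ 2) (hpN : p ∣ N) (hf : IsNewformOf W f)
    (hK : IsImaginaryQuadratic K) (hHN : SatisfiesHeegnerHypothesis N K)
    (h𝔭 : ((p : ℕ) : 𝓞 K) ∈ 𝔭.asIdeal)
    (hι : ∀ (w : InfinitePlace K) (k : 𝓞 K), k ∈ 𝔭.asIdeal ↔ ‖ι.symm (w.embedding (k : K))‖ < 1)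
    (hIrr : ∀ ρ : ModPGaloisRep K (ZMod p) 2, (W.baseChange K).IsTorsionGaloisRep p ρ →
      FramedRep.IsAbsolutelyIrreducible ρ)
    (hκ : κ.IsAnticyclotomic) (hγ : κ.IsTopGenerator γ)
    {ΩK₁ : ℂ} {Ωp₁ : (unrIntegers p)ˣ} {L : UnrSeries p} (hΩK₁ : ΩK₁ ≠ 0)
    (hL : IsBDPLFunction ι 𝔭 κ γ f ΩK₁ ((Ωp₁ : unrIntegers p) : ℂ_[p]) L) :
    ¬ ((PowerSeries.C ((p : ℕ) : unrIntegers p) : UnrSeries p) ∣ L) := by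
  obtain ⟨ΩK, Ωp, Q, hΩK, hQ, hQc⟩ := exists_flatFrame_hasUnitContent_of_thmB_anyLevel hB W hp2 hpN hf
    hK hHN h𝔭 hι hIrr hκ hγ
  obtain ⟨n, hn⟩ := exists_norm_coeff_eq_one_of_hasUnitContent_map
    (hasUnitContent_map_of_isBDPLFunction_of_hasUnitContent hp2 hK hκ hγ hΩK hΩK₁
      (coe_units_unrIntegers_ne_zero Ωp) (coe_units_unrIntegers_ne_zero Ωp₁) hQ hQc hL)
  exact not_C_dvd_of_norm_coeff_eq_one hn

/-- **The registered `stub_E2` of crux (E♭°), WITH the two inputs it needs ADDED as hypotheses** — (B) the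
named fact `Hsieh2014.thmB_exists_isHsiehLFunction_coeff_norm_eq_one_unrPeriod_anyLevel` in front, and (Irr)
the absolute irreducibility of the framed mod-`p` representations of `W/K′` after the frame binders —
and otherwise the stub's binders VERBATIM (most of them unused: CM, rank, admissibility, `𝔭` of degree one).
From the crux's binders: `p ≠ 2` (`5 ≤ p`), `p ∣ N` (bad reduction, `dvd_conductorNorm_iff_not_hasGoodReductionAtPrime`).
A HELPER (conditional on (B), (Irr) undischarged), not the stub. [cite: Hsieh2014, Thm. B p. 712 (Doc. Math. 19)] -/
theorem stub_E2_of_thmB_anyLevel_of_absIrr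
    (hB : thmB_exists_isHsiehLFunction_coeff_norm_eq_one_unrPeriod_anyLevel) :
  ∀ (W : WeierstrassCurve ℚ) [W.IsElliptic] [W.IsGloballyMinimal] (p : ℕ) [Fact p.Prime]
    [NeZero (W.conductorNorm ℤ)] (K : Type) [Field K] [NumberField K],
    W.HasCM → W.analyticRank = 1 → 5 ≤ p → CMInert W p → ¬ Good W p →
    IsImaginaryQuadratic K → SatisfiesHeegnerHypothesis (W.conductorNorm ℤ) K →
    4 < (NumberField.discr K).natAbs →
    (∀ (M : Type) [Field M] [NumberField M], Module.finrank ℚ M = 4 →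
      (∃ x : M, x ^ 2 = ((cmFieldDiscrOfJ W.j : ℤ) : M)) → (∃ y : M, y ^ 2 = ((NumberField.discr K : ℤ) : M)) →
      ¬ p ∣ NumberField.classNumber M) →
    (W.quadraticTwist (NumberField.discr K : ℚ)).entireLFunction 1 ≠ 0 →
    ∀ (κ : ZpExtension K p), κ.IsAnticyclotomic →
      ∀ (γ : Field.absoluteGaloisGroup K) [Fact (κ.IsTopGenerator γ)]
        (𝔭 : HeightOneSpectrum (𝓞 K)), ((p : ℕ) : 𝓞 K) ∈ 𝔭.asIdeal →
        𝔭.asIdeal.ramificationIdx (𝓞 ℚ) = 1 → 𝔭.asIdeal.inertiaDeg (𝓞 ℚ) = 1 →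
        ∀ (f : CuspForm (CongruenceSubgroup.Gamma0 (W.conductorNorm ℤ)) 2), IsNewformOf W f →
          ∀ (ι' : PadicAlgCl p ≃+* ℂ),
            (∀ (w : InfinitePlace K) (k : 𝓞 K), k ∈ 𝔭.asIdeal ↔ ‖ι'.symm (w.embedding (k : K))‖ < 1) →
            ∀ (ΩK : ℂ) (Ωp : (unrIntegers p)ˣ) (L : UnrSeries p), ΩK ≠ 0 →
              IsBDPLFunction ι' 𝔭 κ γ f ΩK ((Ωp : unrIntegers p) : ℂ_[p]) L →
              (∀ ρ : ModPGaloisRep K (ZMod p) 2, (W.baseChange K).IsTorsionGaloisRep p ρ →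
                FramedRep.IsAbsolutelyIrreducible ρ) →
                ¬ ((PowerSeries.C ((p : ℕ) : unrIntegers p) : UnrSeries p) ∣ L) := by
  intro W _ _ p _ _ K _ _ _hCM _hr hp5 _hin hbad hK hHN _hd4 _hadm _hLt κ hκ γ hγ 𝔭 h𝔭 _he _hf f hfW ι'
    hι' ΩK Ωp L hΩK hL hIrr
  have hp2 : p ≠ 2 := by omega
  have hpN : p ∣ W.conductorNorm ℤ := (W.dvd_conductorNorm_iff_not_hasGoodReductionAtPrime p).mpr hbad
  exact not_C_dvd_of_isBDPLFunction_of_thmB_anyLevel hB W hp2 hpN hfW hK hHN h𝔭 hι' hIrr hκ hγ.out hΩK hL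

end Summit.BirchSwinnertonDyer.BirchSwinnertonDyer.Theorems.BiquadraticEisensteinDescentEisensteinDivisibilityCMInertBadFlatAtOneStubE2

end
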